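import Summits.KontsevichZagierPeriods.KontsevichZagierPeriods.Theorems.LinRedNormalFormHoffmanSpanInKZEdsDSGlue

/-!
# Crux `LinRedNormalForm.HoffmanSpanInKZ` (stmt-KontsevichZagierPeriods-15044) — skeleton of line `eds-ds`, v2

The crux: every MZV word generator `[Δ_w, q·∏ ω_ε]` is congruent modulo `KZ.relations` to a
`ℤ`-combination of Hoffman generators `[Δ_w, q'·ω_u]`, `u ∈ {2,3}^×`, `|u| = w`.

Line `eds-ds` (strategist `planner-cstrat-stmt-KontsevichZagierPeriods-15044-s1-0`; lead c3): the canonical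
REGULARISED extended-double-shuffle family of Ihara–Kaneko–Zagier, realised inside the KZ calculus by the
tree theorem `FurushoPentagon.DoubleShuffleInKZ`, certified per weight by the kernel-checkable GF(2) engine
`LinEDS` whose certificates are SHARED with route FurushoPentagon (crux stmt-15058).

v2 (lead c3, 2026-08-17): EVERYTHING IS LANDED EXCEPT THE TAIL —
* vocabulary `LeafDS` (`…EdsDSDefs`, p164258); E5′ `stub_rowZ_of_gds` — the linearised EDS rows vanish at
  every group-like double-shuffle solution with `c_y = 0` (IKZ 2006 Thm 2, abstract; `…EdsDSRows`, p163866);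
  generic cores and masters of the soundness chain (`…EdsDSLeafOfOddDet` p163958, `…EdsDSMasters` p164270,
  `…EdsDSMastersC` p164290); the leaf in weights `14 … 17` from FurushoPentagon's LANDED block certificates
  (`stub_dsLeaf_14_17`, `…EdsDSLeaf`, p164534); the glue (lever `gds_rulesAssociator`, formal spanning,
  descent) with the milestones `stub_leSeventeen : ∀ N ≤ 17, SpanAt N` — THE CRUX HOLDS UNCONDITIONALLY IN
  EVERY WEIGHT `≤ 17` — and `stub_cruxOfDsTail` (`…EdsDSGlue`, p164766).
* The single open stub `stub_dsTail` — the double-shuffle leaf in every weight `≥ 18` — is Ihara–Kaneko–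
  Zagier 2006, Conjecture 1 (regularised EDS is Hoffman-complete in every weight; with Brown 2012 exactly
  Hoffman-completeness; ⟺ `𝔡𝔪𝔯₀`-dimension conjecture's upper half), verified by rank to weight 20/22 in
  print, OPEN; conjecture-sized. Each further weight is one generic-twin file away from FurushoPentagon's
  certificate of that weight (weight 18 in flight there): `leafDS_of_leafRows` + `leafRows_weight_N`.

Sources: K. Ihara, M. Kaneko, D. Zagier, Compos. Math. 142 (2006) Thm 2, Conj. 1; G. Racinet, Publ. Math.
IHÉS 95 (2002) Def. 3.1; H. Furusho, Ann. of Math. 174 (2011) §2; M. Kaneko, M. Noro, K. Tsurumaki, IMA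
Vol. 148 (2008); T. Machide, Tsukuba J. Math. 47 (2023); A. Burmester, N. Confurius, U. Kühn,
arXiv:2406.13630 (2024); F. Brown, Ann. of Math. 175 (2012) Thm 1.1.
-/

noncomputable section

namespace Summit.KontsevichZagierPeriods.KontsevichZagierPeriods.Cruxes.HoffmanSpanInKZ.EdsDS

open Literature.NumberTheory.Transcendental
open Summit.KontsevichZagierPeriods.LinRedNormalForm.HoffmanSpanInKZ (LeafDS stub_cruxOfDsTail)
open Summit.KontsevichZagierPeriods.KontsevichZagierPeriods.Theses.LinRedNormalForm (HoffmanSpanInKZ)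

/-! ## Registered stubs -/

/-- Stub (THE OPEN TAIL of this line, conjecture-sized): the double-shuffle leaf in every weight `≥ 18` —
Ihara–Kaneko–Zagier 2006, Conjecture 1 (regularised extended double shuffle is Hoffman-complete), decidable
per weight by `LinEDS` certificates (weight 18 in flight on route FurushoPentagon). -/
theorem stub_dsTail :
    ∀ s : List ℕ, MZV.IsAdmissible s → 18 ≤ MZV.weight s → LeafDS s := by
  sorry

/-! ## Composition -/

/-- **The crux** `HoffmanSpanInKZ`, by name, from the single open stub through the landed composition
`stub_cruxOfDsTail` (crux `≤ 17` unconditional + the double-shuffle leaf in the weights `≥ 18`). -/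
theorem HoffmanSpanInKZ_of : HoffmanSpanInKZ :=
  stub_cruxOfDsTail stub_dsTail

end Summit.KontsevichZagierPeriods.KontsevichZagierPeriods.Cruxes.HoffmanSpanInKZ.EdsDS
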